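import Mathlib
import HarnessLib

/-!
# Crux K2 `PoloidalWindowRigidity` (stmt-NavierStokesRegularity-19708), line `z_shock` — GN-PRESERVING MONOTONE `C¹` EXTENSION of a
# structure function off a compact value hull (the real-analysis input of RANGE-LOCAL R2 / R2½)

`--supports stmt-NavierStokesRegularity-19708 --as helper` (leafhand-ns-poloidalwindowdoor-3 g8, cell decomp-ns, 2026-08-31).  Class-free,
def-free, MATHLIB ONLY.  **No stub and no summit is closed by this file; Navier–Stokes regularity is NOT proved here (rung 0).**

WHY THIS FILE.  The tree's two-sided Liouville theorems for the 1-D shadow and the oblique 2-D profiles of the autonomous thick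
height-evolution (`…ZShockPSystemNonuniformConst.pSystem_const_nonuniform`, `…ZShockScalarWaveLiouville.scalarWave_const_nonuniform`,
`…ZShockObliqueProfile.obliqueProfile_const_of_supersonic`) ask for a structure function (`κ`, resp. `γ`) defined on ALL of `ℝ` with GLOBAL
positivity, monotonicity (`κ' ≥ 0`) and genuine nonlinearity on EVERY value interval of `ℝ`.  The class delivers the slope function only on the
values actually taken (`…ZShockHeightEvolution.heightEvolution_of_class_autonomy`: `G` analytic AT the values; `…ZShockConeValues`: bounds on
the compact value interval of a cone), and the tree's smooth cutoff `…ZShockSlopeSmoothCutoff` extends `G` off a compact value interval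
WITHOUT preserving sign, monotonicity or genuine nonlinearity.  The standing repair census of the crux (hand 3-g7, exit report
2026-08-31T16:46Z) lists this as «range-local R2/R2½ (extension of κ off the value range) [M]».  This file is the extension step; the
range-local Liouville theorems are in `…ZShockRangeLocal`.

* `exists_contDiff_two_primitive` — a `C¹` function (in the `HasDerivAt` vocabulary) has a `C²` primitive (FTC);
* `integral_exp_left_tail`, `integral_exp_right_tail` — the two exponential tail integrals of the graft;
* `exists_monotone_gn_extension` — ★ THE EXTENSION LEMMA: if `κ` is differentiable on a compact interval `[A, B]` with derivative `κ'`
  continuous there, `0 ≤ κ' ≤ S` on `[A, B]` and `κ'` not identically zero on any open subinterval of `[A, B]`, then for every `δ > 0` there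
  are `κ̃, κ̃' : ℝ → ℝ` with `κ̃ = κ`, `κ̃' = κ'` on `[A, B]`, `HasDerivAt κ̃ (κ̃' v) v` everywhere, `κ̃'` continuous, `0 ≤ κ̃' ≤ S + δ`, `κ̃'`
  not identically zero on ANY open interval of `ℝ`, `κ̃` monotone, `κ A − δ ≤ κ̃ ≤ κ B + δ`.  Construction: `κ̃ = κ(A) + ∫_A g` with the
  CLOSED-FORM continuous density `g = κ'(clamp_{[A,B]} t)·m_A(t)·n_B(t) + ε(m_A − m_A²) + ε(n_B − n_B²)`, `m_A = exp(min(t−A,0)/ε)`,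
  `n_B = exp(min(B−t,0)/ε)`, `ε = min(1, δ/(S+1))`: an exponentially small, strictly positive genuine nonlinearity is grafted outside the
  hull, and since `g` is continuous in closed form no piecewise gluing of derivatives is needed (FTC does it).

[folklore] (elementary real analysis.)  presearch: not a literature statement (textbook calculus); nothing to cite.
-/

noncomputable section

namespace Summit.NavierStokesRegularity.NavierStokesRegularity.Theorems.PoloidalWindowDoorPoloidalWindowRigidityZShockMonotoneExtension

-- the summit and its single sub-problem share the name (CONVENTIONS §1)
set_option linter.dupNamespace false

open Set Filter Topology Function intervalIntegral

/-! ### A `C²` primitive of a `C¹` function -/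

/-- A function with a continuous derivative everywhere has a `C²` primitive (FTC). [folklore] -/
theorem exists_contDiff_two_primitive {f f' : ℝ → ℝ} (hfd : ∀ v, HasDerivAt f (f' v) v) (hf'c : Continuous f') :
    ∃ F : ℝ → ℝ, ContDiff ℝ 2 F ∧ ∀ v, HasDerivAt F (f v) v := by
  have hfc : Continuous f := continuous_iff_continuousAt.2 fun v => (hfd v).continuousAt
  have hf1 : ContDiff ℝ 1 f := by
    have hderiv : deriv f = f' := funext fun v => (hfd v).deriv
    have h : ContDiff ℝ (0 + 1) f := by
      rw [contDiff_succ_iff_deriv]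
      refine ⟨fun v => (hfd v).differentiableAt, by simp, ?_⟩
      rw [hderiv]
      exact contDiff_zero.2 hf'c
    simpa using h
  set F : ℝ → ℝ := fun v => ∫ t in (0 : ℝ)..v, f t with hF_def
  have hFd : ∀ v, HasDerivAt F (f v) v := fun v => (hfc.integral_hasStrictDerivAt 0 v).hasDerivAt
  refine ⟨F, ?_, hFd⟩
  have hderiv : deriv F = f := funext fun v => (hFd v).deriv
  have h2 : ContDiff ℝ (1 + 1) F := by
    rw [contDiff_succ_iff_deriv]
    exact ⟨fun v => (hFd v).differentiableAt, by simp, by rw [hderiv]; exact hf1⟩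
  simpa [one_add_one_eq_two] using h2

/-! ### Two elementary exponential tail integrals -/

/-- `∫_v^A e^{(t−A)/ε} dt = ε(1 − e^{(v−A)/ε})`. [folklore] -/
theorem integral_exp_left_tail {ε A v : ℝ} (hε : 0 < ε) :
    ∫ t in v..A, Real.exp ((t - A) / ε) = ε * (1 - Real.exp ((v - A) / ε)) := by
  have hd : ∀ t, HasDerivAt (fun t => ε * Real.exp ((t - A) / ε)) (Real.exp ((t - A) / ε)) t := by
    intro t
    have h1 : HasDerivAt (fun t => (t - A) / ε) (1 / ε) t := ((hasDerivAt_id t).sub_const A).div_const ε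
    have h2 := (h1.exp).const_mul ε
    refine h2.congr_deriv ?_
    field_simp
  have hint : IntervalIntegrable (fun t => Real.exp ((t - A) / ε)) MeasureTheory.volume v A :=
    (Real.continuous_exp.comp ((continuous_id.sub continuous_const).div_const ε)).intervalIntegrable v A
  rw [integral_eq_sub_of_hasDerivAt (fun t _ => hd t) hint]
  simp only [sub_self, zero_div, Real.exp_zero]
  ring

/-- `∫_B^v e^{(B−t)/ε} dt = ε(1 − e^{(B−v)/ε})`. [folklore] -/
theorem integral_exp_right_tail {ε B v : ℝ} (hε : 0 < ε) :
    ∫ t in B..v, Real.exp ((B - t) / ε) = ε * (1 - Real.exp ((B - v) / ε)) := by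
  have hd : ∀ t, HasDerivAt (fun t => -ε * Real.exp ((B - t) / ε)) (Real.exp ((B - t) / ε)) t := by
    intro t
    have h1 : HasDerivAt (fun t => (B - t) / ε) ((0 - 1) / ε) t :=
      ((hasDerivAt_const t B).sub (hasDerivAt_id t)).div_const ε
    have h2 := (h1.exp).const_mul (-ε)
    refine h2.congr_deriv ?_
    field_simp
    ring
  have hint : IntervalIntegrable (fun t => Real.exp ((B - t) / ε)) MeasureTheory.volume B v :=
    (Real.continuous_exp.comp ((continuous_const.sub continuous_id).div_const ε)).intervalIntegrable B v
  rw [integral_eq_sub_of_hasDerivAt (fun t _ => hd t) hint]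
  simp only [sub_self, zero_div, Real.exp_zero]
  ring

/-! ### The GN-preserving monotone extension lemma -/

/-- ★ **Monotone, genuinely-nonlinear `C¹` extension off a compact value hull.**  Let `κ` be differentiable at every point of `[A, B]` with
derivative `κ'`, `κ'` continuous on `[A, B]`, `0 ≤ κ' ≤ S` on `[A, B]`, and `κ'` not identically zero on any open subinterval of `[A, B]`.
Then for every `δ > 0` there are `κ̃ κ̃' : ℝ → ℝ`, agreeing with `κ, κ'` on `[A, B]`, with `HasDerivAt κ̃ (κ̃' v) v` for all `v`, `κ̃'`
continuous, `0 ≤ κ̃' ≤ S + δ`, `κ̃'` not identically zero on ANY nontrivial open interval of `ℝ`, `κ̃` monotone, and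
`κ A − δ ≤ κ̃ ≤ κ B + δ`.  (Outside the hull the derivative is the exponentially decaying, strictly positive graft
`κ'(A)e^{(t−A)/ε} + ε(e^{(t−A)/ε} − e^{2(t−A)/ε})` on the left, symmetrically on the right.) [folklore] -/
theorem exists_monotone_gn_extension {κ κ' : ℝ → ℝ} {A B S δ : ℝ} (hAB : A ≤ B) (hδ : 0 < δ)
    (hκd : ∀ v ∈ Icc A B, HasDerivAt κ (κ' v) v) (hκ'c : ContinuousOn κ' (Icc A B))
    (hgnl : ∀ v ∈ Icc A B, 0 ≤ κ' v) (hS : ∀ v ∈ Icc A B, κ' v ≤ S)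
    (hgn : ∀ a b : ℝ, A ≤ a → a < b → b ≤ B → ∃ v ∈ Ioo a b, κ' v ≠ 0) :
    ∃ κe κe' : ℝ → ℝ, (∀ v ∈ Icc A B, κe v = κ v) ∧ (∀ v ∈ Icc A B, κe' v = κ' v) ∧
      (∀ v, HasDerivAt κe (κe' v) v) ∧ Continuous κe' ∧ (∀ v, 0 ≤ κe' v) ∧ (∀ v, κe' v ≤ S + δ) ∧
      (∀ a b : ℝ, a < b → ∃ v ∈ Ioo a b, κe' v ≠ 0) ∧ Monotone κe ∧
      (∀ v, κ A - δ ≤ κe v) ∧ (∀ v, κe v ≤ κ B + δ) := by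
  have hA : A ∈ Icc A B := ⟨le_rfl, hAB⟩
  have hB : B ∈ Icc A B := ⟨hAB, le_rfl⟩
  have hS0 : 0 ≤ S := (hgnl A hA).trans (hS A hA)
  -- the small parameter
  set ε : ℝ := min 1 (δ / (S + 1)) with hε_def
  have hS1 : 0 < S + 1 := by linarith
  have hε0 : 0 < ε := lt_min one_pos (div_pos hδ hS1)
  have hε1 : ε ≤ 1 := min_le_left _ _
  have hεδ : (S + ε) * ε ≤ δ := by
    have h1 : ε ≤ δ / (S + 1) := min_le_right _ _
    have h2 : (S + 1) * ε ≤ δ := by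
      calc (S + 1) * ε ≤ (S + 1) * (δ / (S + 1)) := by gcongr
        _ = δ := by field_simp
    nlinarith
  have hεδ' : ε / 4 + ε / 4 ≤ δ := by
    have h1 : ε ≤ δ / (S + 1) := min_le_right _ _
    have h2 : δ / (S + 1) ≤ δ := div_le_self hδ.le (by linarith)
    linarith
  -- the grafts
  set mA : ℝ → ℝ := fun t => Real.exp (min (t - A) 0 / ε) with hmA_def
  set nB : ℝ → ℝ := fun t => Real.exp (min (B - t) 0 / ε) with hnB_def
  have hmAc : Continuous mA := Real.continuous_exp.comp (((continuous_id.sub continuous_const).min continuous_const).div_const ε)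
  have hnBc : Continuous nB := Real.continuous_exp.comp (((continuous_const.sub continuous_id).min continuous_const).div_const ε)
  have hmA_pos : ∀ t, 0 < mA t := fun t => Real.exp_pos _
  have hnB_pos : ∀ t, 0 < nB t := fun t => Real.exp_pos _
  have hmA_le : ∀ t, mA t ≤ 1 := fun t =>
    Real.exp_le_one_iff.2 (div_nonpos_iff.2 (Or.inr ⟨min_le_right _ _, hε0.le⟩))
  have hnB_le : ∀ t, nB t ≤ 1 := fun t =>
    Real.exp_le_one_iff.2 (div_nonpos_iff.2 (Or.inr ⟨min_le_right _ _, hε0.le⟩))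
  have hmA_one : ∀ t, A ≤ t → mA t = 1 := by
    intro t ht
    simp only [hmA_def, min_eq_right (sub_nonneg.2 ht), zero_div, Real.exp_zero]
  have hnB_one : ∀ t, t ≤ B → nB t = 1 := by
    intro t ht
    simp only [hnB_def, min_eq_right (sub_nonneg.2 ht), zero_div, Real.exp_zero]
  have hmA_left : ∀ t, t ≤ A → mA t = Real.exp ((t - A) / ε) := by
    intro t ht
    simp only [hmA_def, min_eq_left (sub_nonpos.2 ht)]
  have hnB_right : ∀ t, B ≤ t → nB t = Real.exp ((B - t) / ε) := by
    intro t ht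
    simp only [hnB_def, min_eq_left (sub_nonpos.2 ht)]
  have hmA_lt : ∀ t, t < A → mA t < 1 := by
    intro t ht
    rw [hmA_left t ht.le, ← Real.exp_zero]
    exact Real.exp_lt_exp.2 (div_neg_of_neg_of_pos (by linarith) hε0)
  have hnB_lt : ∀ t, B < t → nB t < 1 := by
    intro t ht
    rw [hnB_right t ht.le, ← Real.exp_zero]
    exact Real.exp_lt_exp.2 (div_neg_of_neg_of_pos (by linarith) hε0)
  have hquad : ∀ m : ℝ, m - m ^ 2 ≤ 1 / 4 := fun m => by nlinarith [sq_nonneg (m - 1 / 2)]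
  have hquad' : ∀ m : ℝ, 0 < m → m ≤ 1 → 0 ≤ m - m ^ 2 := fun m h0 h1 => by nlinarith
  have hquad'' : ∀ m : ℝ, 0 < m → m < 1 → 0 < m - m ^ 2 := fun m h0 h1 => by nlinarith
  -- the clamp onto the hull and the clamped derivative
  set cl : ℝ → ℝ := fun t => max A (min B t) with hcl_def
  have hclc : Continuous cl := continuous_const.max (continuous_const.min continuous_id)
  have hcl_mem : ∀ t, cl t ∈ Icc A B := fun t => ⟨le_max_left _ _, max_le hAB (min_le_left _ _)⟩
  have hcl_id : ∀ t ∈ Icc A B, cl t = t := by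
    intro t ht
    simp only [hcl_def, min_eq_right ht.2, max_eq_right ht.1]
  have hcl_left : ∀ t, t ≤ A → cl t = A := fun t ht => max_eq_left ((min_le_right B t).trans ht)
  have hcl_right : ∀ t, B ≤ t → cl t = B := by
    intro t ht
    simp only [hcl_def, min_eq_left ht, max_eq_right hAB]
  set e : ℝ → ℝ := fun t => κ' (cl t) with he_def
  have hec : Continuous e := hκ'c.comp_continuous hclc hcl_mem
  have he0 : ∀ t, 0 ≤ e t := fun t => hgnl _ (hcl_mem t)
  have heS : ∀ t, e t ≤ S := fun t => hS _ (hcl_mem t)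
  -- the density and the extension
  set g : ℝ → ℝ := fun t => e t * (mA t * nB t) + ε * (mA t - mA t ^ 2) + ε * (nB t - nB t ^ 2) with hg_def
  have hgc : Continuous g :=
    ((hec.mul (hmAc.mul hnBc)).add (continuous_const.mul (hmAc.sub (hmAc.pow 2)))).add
      (continuous_const.mul (hnBc.sub (hnBc.pow 2)))
  have hg_on : ∀ t ∈ Icc A B, g t = κ' t := by
    intro t ht
    simp only [hg_def, he_def, hmA_one t ht.1, hnB_one t ht.2, hcl_id t ht]
    ring
  have hg0 : ∀ t, 0 ≤ g t := by
    intro t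
    have h1 : 0 ≤ e t * (mA t * nB t) := mul_nonneg (he0 t) (mul_nonneg (hmA_pos t).le (hnB_pos t).le)
    have h2 : 0 ≤ ε * (mA t - mA t ^ 2) := mul_nonneg hε0.le (hquad' _ (hmA_pos t) (hmA_le t))
    have h3 : 0 ≤ ε * (nB t - nB t ^ 2) := mul_nonneg hε0.le (hquad' _ (hnB_pos t) (hnB_le t))
    simp only [hg_def]
    linarith
  have hgS : ∀ t, g t ≤ S + δ := by
    intro t
    have h1 : e t * (mA t * nB t) ≤ S := by
      have hmn : mA t * nB t ≤ 1 := mul_le_one₀ (hmA_le t) (hnB_pos t).le (hnB_le t)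
      calc e t * (mA t * nB t) ≤ e t * 1 := by gcongr; exact he0 t
        _ = e t := mul_one _
        _ ≤ S := heS t
    have h2 : ε * (mA t - mA t ^ 2) ≤ ε / 4 := by
      have := hquad (mA t)
      nlinarith
    have h3 : ε * (nB t - nB t ^ 2) ≤ ε / 4 := by
      have := hquad (nB t)
      nlinarith
    simp only [hg_def]
    linarith
  have hg_left : ∀ t, t ≤ A → g t ≤ (S + ε) * Real.exp ((t - A) / ε) := by
    intro t ht
    have hm := hmA_left t ht
    have hn := hnB_one t (ht.trans hAB)
    have hm0 : 0 < Real.exp ((t - A) / ε) := Real.exp_pos _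
    have h1 : e t * (mA t * nB t) ≤ S * Real.exp ((t - A) / ε) := by
      rw [hm, hn, mul_one]
      gcongr
      exact heS t
    have h2 : ε * (mA t - mA t ^ 2) ≤ ε * Real.exp ((t - A) / ε) := by
      rw [hm]
      gcongr
      nlinarith [sq_nonneg (Real.exp ((t - A) / ε))]
    have h3 : ε * (nB t - nB t ^ 2) = 0 := by rw [hn]; ring
    simp only [hg_def] at *
    nlinarith
  have hg_right : ∀ t, B ≤ t → g t ≤ (S + ε) * Real.exp ((B - t) / ε) := by
    intro t ht
    have hn := hnB_right t ht
    have hm := hmA_one t (hAB.trans ht)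
    have hn0 : 0 < Real.exp ((B - t) / ε) := Real.exp_pos _
    have h1 : e t * (mA t * nB t) ≤ S * Real.exp ((B - t) / ε) := by
      rw [hm, hn, one_mul]
      gcongr
      exact heS t
    have h2 : ε * (nB t - nB t ^ 2) ≤ ε * Real.exp ((B - t) / ε) := by
      rw [hn]
      gcongr
      nlinarith [sq_nonneg (Real.exp ((B - t) / ε))]
    have h3 : ε * (mA t - mA t ^ 2) = 0 := by rw [hm]; ring
    simp only [hg_def] at *
    nlinarith
  -- genuine nonlinearity of the graft outside the hull
  have hg_pos_left : ∀ t, t < A → 0 < g t := by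
    intro t ht
    have h1 : 0 ≤ e t * (mA t * nB t) := mul_nonneg (he0 t) (mul_nonneg (hmA_pos t).le (hnB_pos t).le)
    have h2 : 0 < ε * (mA t - mA t ^ 2) := mul_pos hε0 (hquad'' _ (hmA_pos t) (hmA_lt t ht))
    have h3 : 0 ≤ ε * (nB t - nB t ^ 2) := mul_nonneg hε0.le (hquad' _ (hnB_pos t) (hnB_le t))
    simp only [hg_def]
    linarith
  have hg_pos_right : ∀ t, B < t → 0 < g t := by
    intro t ht
    have h1 : 0 ≤ e t * (mA t * nB t) := mul_nonneg (he0 t) (mul_nonneg (hmA_pos t).le (hnB_pos t).le)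
    have h2 : 0 ≤ ε * (mA t - mA t ^ 2) := mul_nonneg hε0.le (hquad' _ (hmA_pos t) (hmA_le t))
    have h3 : 0 < ε * (nB t - nB t ^ 2) := mul_pos hε0 (hquad'' _ (hnB_pos t) (hnB_lt t ht))
    simp only [hg_def]
    linarith
  -- the extension `κe = κ(A) + ∫_A g`
  set κe : ℝ → ℝ := fun v => κ A + ∫ t in A..v, g t with hκe_def
  have hκed : ∀ v, HasDerivAt κe (g v) v := fun v =>
    ((hgc.integral_hasStrictDerivAt A v).hasDerivAt).const_add (κ A)
  have hκe_diff : Differentiable ℝ κe := fun v => (hκed v).differentiableAt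
  have hκe_mono : Monotone κe :=
    monotone_of_deriv_nonneg hκe_diff fun v => by rw [(hκed v).deriv]; exact hg0 v
  have hκe_on : ∀ v ∈ Icc A B, κe v = κ v := by
    intro v hv
    have hsub : uIcc A v ⊆ Icc A B := by
      rw [uIcc_of_le hv.1]; exact Icc_subset_Icc le_rfl hv.2
    have h1 : ∫ t in A..v, g t = ∫ t in A..v, κ' t := integral_congr fun t ht => hg_on t (hsub ht)
    have h2 : ∫ t in A..v, κ' t = κ v - κ A :=
      integral_eq_sub_of_hasDerivAt (fun t ht => hκd t (hsub ht)) ((hκ'c.mono hsub).intervalIntegrable)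
    simp only [hκe_def, h1, h2]
    ring
  have hκe_FTC : ∀ a b : ℝ, ∫ t in a..b, g t = κe b - κe a := fun a b =>
    integral_eq_sub_of_hasDerivAt (fun t _ => hκed t) (hgc.intervalIntegrable a b)
  -- the tail bounds
  have hleft : ∀ v, v ≤ A → κ A - δ ≤ κe v := by
    intro v hv
    have h1 : ∫ t in v..A, g t ≤ ∫ t in v..A, (S + ε) * Real.exp ((t - A) / ε) :=
      integral_mono_on hv (hgc.intervalIntegrable v A)
        ((continuous_const.mul (Real.continuous_exp.comp ((continuous_id.sub continuous_const).div_const ε))).intervalIntegrable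
          v A)
        fun t ht => hg_left t ht.2
    have h2 : ∫ t in v..A, (S + ε) * Real.exp ((t - A) / ε) = (S + ε) * (ε * (1 - Real.exp ((v - A) / ε))) := by
      rw [intervalIntegral.integral_const_mul, integral_exp_left_tail hε0]
    have h3 : (S + ε) * (ε * (1 - Real.exp ((v - A) / ε))) ≤ (S + ε) * ε := by
      have hx : 0 < Real.exp ((v - A) / ε) := Real.exp_pos _
      have hSε : 0 ≤ S + ε := by linarith
      have hprod : 0 ≤ (S + ε) * ε * Real.exp ((v - A) / ε) := mul_nonneg (mul_nonneg hSε hε0.le) hx.le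
      calc (S + ε) * (ε * (1 - Real.exp ((v - A) / ε))) = (S + ε) * ε - (S + ε) * ε * Real.exp ((v - A) / ε) := by ring
        _ ≤ (S + ε) * ε := by linarith
    have h4 : ∫ t in v..A, g t = κe A - κe v := hκe_FTC v A
    have h5 : κe A = κ A := hκe_on A hA
    linarith
  have hright : ∀ v, B ≤ v → κe v ≤ κ B + δ := by
    intro v hv
    have h1 : ∫ t in B..v, g t ≤ ∫ t in B..v, (S + ε) * Real.exp ((B - t) / ε) :=
      integral_mono_on hv (hgc.intervalIntegrable B v)
        ((continuous_const.mul (Real.continuous_exp.comp ((continuous_const.sub continuous_id).div_const ε))).intervalIntegrable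
          B v)
        fun t ht => hg_right t ht.1
    have h2 : ∫ t in B..v, (S + ε) * Real.exp ((B - t) / ε) = (S + ε) * (ε * (1 - Real.exp ((B - v) / ε))) := by
      rw [intervalIntegral.integral_const_mul, integral_exp_right_tail hε0]
    have h3 : (S + ε) * (ε * (1 - Real.exp ((B - v) / ε))) ≤ (S + ε) * ε := by
      have hx : 0 < Real.exp ((B - v) / ε) := Real.exp_pos _
      have hSε : 0 ≤ S + ε := by linarith
      have hprod : 0 ≤ (S + ε) * ε * Real.exp ((B - v) / ε) := mul_nonneg (mul_nonneg hSε hε0.le) hx.le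
      calc (S + ε) * (ε * (1 - Real.exp ((B - v) / ε))) = (S + ε) * ε - (S + ε) * ε * Real.exp ((B - v) / ε) := by ring
        _ ≤ (S + ε) * ε := by linarith
    have h4 : ∫ t in B..v, g t = κe v - κe B := hκe_FTC B v
    have h5 : κe B = κ B := hκe_on B hB
    linarith
  refine ⟨κe, g, hκe_on, hg_on, hκed, hgc, hg0, hgS, ?_, hκe_mono, ?_, ?_⟩
  · -- genuine nonlinearity on every interval
    intro a b hab
    by_cases h1 : a < A
    · -- a point of `(a, b)` to the left of `A`
      refine ⟨(a + min b A) / 2, ⟨?_, ?_⟩, (hg_pos_left _ ?_).ne'⟩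
      · have : a < min b A := lt_min hab h1
        linarith
      · have : min b A ≤ b := min_le_left _ _
        have : a < min b A := lt_min hab h1
        linarith
      · have : min b A ≤ A := min_le_right _ _
        have : a < min b A := lt_min hab h1
        linarith
    · push Not at h1
      by_cases h2 : B < b
      · refine ⟨(max a B + b) / 2, ⟨?_, ?_⟩, (hg_pos_right _ ?_).ne'⟩
        · have : a ≤ max a B := le_max_left _ _
          have : max a B < b := max_lt hab h2
          linarith
        · have : max a B < b := max_lt hab h2
          linarith
        · have : B ≤ max a B := le_max_right _ _
          have : max a B < b := max_lt hab h2
          linarith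
      · push Not at h2
        obtain ⟨v, hv, hv0⟩ := hgn a b h1 hab h2
        exact ⟨v, hv, by rwa [hg_on v ⟨h1.trans hv.1.le, hv.2.le.trans h2⟩]⟩
  · intro v
    rcases le_total v A with h | h
    · exact hleft v h
    · have : κe A ≤ κe v := hκe_mono h
      rw [hκe_on A hA] at this
      linarith
  · intro v
    rcases le_total v B with h | h
    · have : κe v ≤ κe B := hκe_mono h
      rw [hκe_on B hB] at this
      linarith
    · exact hright v h

end Summit.NavierStokesRegularity.NavierStokesRegularity.Theorems.PoloidalWindowDoorPoloidalWindowRigidityZShockMonotoneExtension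

end
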